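import Literature.MathematicalPhysics.QuantumFieldTheory.QCDOS
import HarnessLib

/-!
# The centre-stabilised, flavour-twisted lattice QCD functional on `ℤ_{N_t} × (ℤ/N_s)³`
# (QCD on `ℝ³ × S¹_L`, the Ünsal–Yaffe / `ℤ_{N_c}`-QCD setting)

Topic `Literature/MathematicalPhysics/QuantumFieldTheory`; definition request
`defn-QCDSlabFunctional` of route `CentreStabilisedCircle` (sub-problem `QCD` of `QuantumFields`),
whose items `SmallCircleGap`, `CircleContinuity`, `SlabToTorus`, `CFCCentreStability` inline the
whole construction as one `let ρ/Cfg/V/I/Gr/D/Z/E/g/O/Gap` prefix. The declarations below ARE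
those terms, packaged under names; the bodies are kept syntactically parallel to the inlined ones
and `QCDRegularisation.HasCircleClustering reg m P hP θP ↔ <the inlined Gap reg m P hP θP>` holds
by `Iff.rfl` (checked in a scratch file importing the route's barrier vocabulary, under
`set_option smartUnfolding false` so that the two structurally recursive `timeHolonomy` copies
unfold; not shippable here, see "Import cone"), so a restate of the items through this file is
definitional.

## Import cone (why the pure-gauge slab vocabulary is re-declared here)

The route's inlined terms use `Literature.Barriers.QuantumFields.FiniteTemperature.{Site, Dir,
Config, weight, haar, polyakovTrace}` of the barrier file `FiniteTemperatureDeconfinement.lean`,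
and the sibling `QCDSlab.lean` (route `FemtoStepScaling`: time = coordinate `0`, antiperiodic
seam sign, no deformation, no twist) builds on the same import. The requesting planner recorded
on the item (evidence `defreq_constraint.md`): "cone guardrail: the defining module must not
import `Literature.Barriers.QuantumFields.FiniteTemperatureDeconfinement` (unproved XL fact would
re-enter every using route's import cone); inline the slab vocabulary or split it out
barrier-free first". Hence the sub-namespace `SlabGauge` below: VERBATIM copies (same bodies, so
definitionally equal — `example : @SlabGauge.weight = @FiniteTemperature.weight := rfl` etc.,
scratch-checked) of the eleven pure-gauge declarations `Site`, `Dir`, `Site.shift`, `Config`,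
`plaquette`, `minusAction`, `weight`, `haar`, `timeHolonomy`, `polyakovLine`, `polyakovTrace`; a
later maintenance pass can make either copy an `abbrev` of the other without changing any
statement. Nothing else of the barrier file is copied; this file imports `QCDOS.lean` only.

## The model

Gauge group `SU(3)` (fundamental representation), `N_f` Wilson quark flavours (`r = 1`), on the
periodic lattice `ℤ_{N_t} × (ℤ/N_s)³`: a CIRCLE of `N_t` sites (direction `none`; physical size
`L = a N_t`; read as the `ℤ⁴`-coordinate `3` when local observables of `ℤ⁴` are placed, so that
the `γ`-matrix on the circle is `euclideanGamma 3` and the coordinate `0` of `ℤ⁴` — the Euclidean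
time of the tree's torus statements — is a NON-compact slab direction) times a three-torus of side
`N_s`. The Boltzmann weight is the product of

* the isotropic Wilson weight `exp(β Σ_P Re tr U_P)` (`SlabGauge.weight ρ β β`, `J_E = J_M = β`;
  the tree's normalisation `β = 2/g₀²` of `wilsonMeasure`, whose density `exp(−β Σ_P (3 − Re tr
  U_P))` differs by the constant `exp(−3β·#P)` cancelling in expectations)
  [cite: BorgsSeiler1983, §II.3 (II.20)];
* the **double-trace (centre-stabilising) deformation** `exp(−h Σ_{x⃗} |tr P_{x⃗}|²)`, `P_{x⃗}` the
  Polyakov loop (holonomy once around the circle) at the spatial site `x⃗`: Ünsal–Yaffe's deformed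
  action `S^YM + ΔS`, `ΔS = N_t^{−3} Σ_{x⃗ ∈ Λ₃} P[Ω(x⃗)]`, `P[Ω] = Σ_{n=1}^{⌊N/2⌋} a_n |tr Ω^n|²`,
  which for `N = 3` is the single term `a₁|tr Ω|²` (`h = a₁/N_t³`)
  [cite: UnsalYaffe2008, §I (deformed action and deformation potential P(Ω))];
* the **signed Wilson–Dirac Berezin factor** `∫dψ̄dψ X e^{−ψ̄ D(U; m, θ) ψ}` with FLAVOUR-TWISTED
  boundary phases around the circle: `D` is the tree's Wilson–Dirac formula (`wilsonDirac`,
  Montvay–Münster (4.85) at `a = 1` / (5.5), tree link orientation), flavour-diagonal with bare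
  masses `m_f`, with the phase `e^{iθ_f}` on the hops `ψ̄_{(N_t−1,x⃗)} (1−γ) U ψ_{(0,x⃗)}` crossing
  the seam forwards and `e^{−iθ_f}` on the reverse hops `ψ̄_{(0,x⃗)} (1+γ) U⁻¹ ψ_{(N_t−1,x⃗)}` —
  the boundary condition `ψ_f(t + N_t) = e^{iθ_f} ψ_f(t)` for fields stored on `t ∈ ℤ_{N_t}`.
  `θ_f = 0` is the PERIODIC operator of the tree (`qcdTorusExpect`: the `(−1)^F`-twisted trace),
  `θ_f = π` the antiperiodic (thermal) one (`seamSign (−1)` of `QCDSlab.lean`), and Kouno et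
  al.'s `ℤ_{N_c}`-symmetric "`q_f(x⃗, β) = −exp(iθ_f) q_f(x⃗, 0)`, `θ_f = θ₁ + 2π(f−1)/N`" is
  `θ_f + π` here [cite: KounoEtAl2012, §II eq. (3) (TBC) and eqs. (4)–(5)]. Equivalently (loc.
  cit.; on the lattice Hasenfratz–Karsch's `e^{±aμ}` on the forward/backward temporal hops,
  Montvay–Münster §5.4.3 (5.263) with (5.272), moved to the last slice as in the remark after
  (5.277)) the twist is an imaginary quark chemical potential `aμ_f = ±iθ_f/N_t`
  [cite: MontvayMunster1994, §5.4.3 (5.263) and (5.272)] [cite: HasenfratzKarsch1983] [cite: RobergeWeiss1986].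

## Contents

* `SlabGauge.*` (pure gauge, any `d`, `G`, `ρ`; see "Import cone");
* `QCDCircleConfig Nt Ns`, `CircleQuarkVar/CircleFermiIdx/CircleFermiAlg Nf Nt Ns`,
  `circleQuarkEquiv`; `flavourTwistPhase ϑ μ x`, `qcdCircleDirac U mq θ` (request (i));
* `polyakovDeformationWeight h U`, `qcdCirclePartition Nt Ns β h mq θ X` (un-normalised) and
  `qcdCircleExpect Nt Ns β h mq θ X = Z(X)/Z(1)` (request (ii), "QCDSlabFunctional"; junk `0` if
  `Z(1) = 0`);
* `circleSite`, `circleGaugeLift` (the `(N_s,N_s,N_s,N_t)`-periodic lift of the slab gauge field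
  to `ℤ⁴`, coordinate `3` = the circle, `finSuccEquiv' 3 : Fin 4 ≃ Option (Fin 3)` on directions),
  `circleQuarkVarOfBox`, `QCDLatticeObservable.onCircle A Nt Ns v U` (request (iii)) and
  `qcdCircleConnectedCorr Nt Ns β h mq θ A B n` (`B` translated by `n` in the direction `0`);
* `QCDRegularisation.HasCircleClusteringAt reg m P hP θP Δ` / `.HasCircleClustering` — the common
  tail `Gap` of the items: along `reg` at renormalised masses `m`, under the deformation profile
  `hP k N_t` and twist profile `θP k N_t`, for all large `k`, all `N_t` in the window `P k N_t`, all
  spatial tori `2S+1 ≥ N_t` and separations `n ≤ S`, every pair of gauge-invariant local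
  observables has connected correlation `≤ C e^{−Δ a_k n}`;
* proved API: `flavourTwistPhase_zero/_some`, `norm_flavourTwistPhase`, `qcdCircleDirac_of_ne`,
  `polyakovDeformationWeight_zero/_pos`, `qcdCirclePartition_deformation_zero`,
  `qcdCircleExpect_one`, `finSuccEquiv'_symm_three` / `finSuccEquiv'_three_elim` (the items' axis
  map `μ.elim 3 Fin.castSucc` is the inverse of `finSuccEquiv' 3`), `circleSite_add_single` (the
  projection `ℤ⁴ → ℤ_{N_t} × (ℤ/N_s)³` intertwines unit shifts), `plaquetteHolonomyZd_circleGaugeLift`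
  (plaquettes of the lift are the lattice plaquettes), `QCDLatticeObservable.onCircle_one`,
  `qcdCircleConnectedCorr_one_right`, `HasCircleClusteringAt.mono` (shrinking the window), `.of_le`
  (lowering the rate), `HasCircleClustering.mono`.

NOT here: request (iv), the identification at `N_t = N_s = 2S+1`, `h = 0`, `θ = 0` with
`qcdTorusExpect` / `qcdLatticeConnectedCorr` up to the site relabelling `(t, x⃗) ↔ Fin.snoc x⃗ t`
and a relabelling of quark variables — it is the route's item `SlabToTorus`; the ingredients on
this side are `flavourTwistPhase_zero`, `qcdCirclePartition_deformation_zero` and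
`GrassmannAlgebra.berezin_map` (`GrassmannIntegralSubstitution.lean`). No positivity of `Z(1)`
(sign of the twisted Wilson determinant) and no clustering claim is made.
-/

open MeasureTheory Filter
open Literature.MathematicalPhysics.QuantumLattice

noncomputable section

namespace Literature.MathematicalPhysics.QuantumFieldTheory

/-! ### `SlabGauge`: the periodic lattice `ℤ_{L₀} × (ℤ/L)^d` and its Wilson weight (barrier-free
copies of `Literature.Barriers.QuantumFields.FiniteTemperature.*`, same bodies) -/

namespace SlabGauge

/-- Sites of the lattice `ℤ_{L₀} × (ℤ/L)^d`: a coordinate on the circle `ℤ_{L₀}` and a site of the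
periodic box `(ℤ/L)^d` (copy of `FiniteTemperature.Site`). [cite: BorgsSeiler1983, §II.3 (II.20) (pp. 335–336)] -/
abbrev Site (d L₀ L : ℕ) : Type := ZMod L₀ × (Fin d → ZMod L)

/-- Lattice directions: `none` is the circle direction, `some i` the direction `i` of the box
(copy of `FiniteTemperature.Dir`). [folklore] -/
abbrev Dir (d : ℕ) : Type := Option (Fin d)

variable {d L₀ L : ℕ}

/-- The neighbouring site `x + e_μ`, periodically (copy of `FiniteTemperature.Site.shift`). [folklore] -/
def Site.shift (x : Site d L₀ L) : Dir d → Site d L₀ L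
  | none => (x.1 + 1, x.2)
  | some i => (x.1, x.2 + Pi.single i 1)

/-- Configurations: a group element on every positively oriented link `(x, μ)` (copy of
`FiniteTemperature.Config`). [folklore] -/
abbrev Config (d L₀ L : ℕ) (G : Type*) : Type _ := Site d L₀ L × Dir d → G

variable {G : Type*} [Group G] {N : ℕ}

/-- Plaquette holonomy `U(x,μ) U(x+e_μ,ν) U(x+e_ν,μ)⁻¹ U(x,ν)⁻¹` (copy of
`FiniteTemperature.plaquette`). [cite: BorgsSeiler1983, §II.2 (II.2) (p. 332)] -/
def plaquette (U : Config d L₀ L G) (x : Site d L₀ L) (μ ν : Dir d) : G :=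
  U (x, μ) * U (x.shift μ, ν) * (U (x.shift ν, μ))⁻¹ * (U (x, ν))⁻¹

variable (ρ : G →* Matrix (Fin N) (Fin N) ℂ)

/-- Minus the two-coupling Wilson action: `J_E Σ Re tr ρ(U_P)` over the plaquettes containing the
circle direction plus `J_M Σ Re tr ρ(U_P)` over the plaquettes of the box (copy of
`FiniteTemperature.minusAction`). [cite: BorgsSeiler1983, §II.3 (II.20) (pp. 335–336); §III.1 (III.1)–(III.2) (p. 344)] -/
def minusAction [NeZero L₀] [NeZero L] (JE JM : ℝ) (U : Config d L₀ L G) : ℝ :=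
  JE * ∑ x : Site d L₀ L, ∑ i : Fin d, (ρ (plaquette U x none (some i))).trace.re +
  JM * ∑ x : Site d L₀ L, ∑ p : {p : Fin d × Fin d // p.1 < p.2},
    (ρ (plaquette U x (some p.1.1) (some p.1.2))).trace.re

/-- The Boltzmann weight `e^{−S_W}` (copy of `FiniteTemperature.weight`). [cite: BorgsSeiler1983, §II.3 (II.20) (pp. 335–336)] -/
def weight [NeZero L₀] [NeZero L] (JE JM : ℝ) (U : Config d L₀ L G) : ℝ :=
  Real.exp (minusAction ρ JE JM U)

/-- The Boltzmann weight is positive. [folklore] -/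
theorem weight_pos [NeZero L₀] [NeZero L] (JE JM : ℝ) (U : Config d L₀ L G) :
    0 < weight ρ JE JM U :=
  Real.exp_pos _

variable [TopologicalSpace G] [IsTopologicalGroup G] [CompactSpace G] [MeasurableSpace G]
  [BorelSpace G]

variable (d L₀ L G) in
/-- The a-priori measure `∏_{links} dg`, product of normalised Haar measures (copy of
`FiniteTemperature.haar`). [cite: BorgsSeiler1983, §II.3 (II.20)–Lemma II.3 (p. 336)] -/
def haar [NeZero L₀] [NeZero L] : Measure (Config d L₀ L G) :=
  Measure.pi fun _ : Site d L₀ L × Dir d => haarProbability G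

/-- The a-priori measure is a probability measure. [folklore] -/
instance haar_isProbabilityMeasure [NeZero L₀] [NeZero L] :
    IsProbabilityMeasure (haar d L₀ L G) := by
  unfold haar; infer_instance

omit [TopologicalSpace G] [IsTopologicalGroup G] [CompactSpace G] [MeasurableSpace G]
  [BorelSpace G] in
/-- Holonomy of `n` forward steps around the circle from `y` (copy of
`FiniteTemperature.timeHolonomy`). [folklore] -/
def timeHolonomy (U : Config d L₀ L G) : ℕ → Site d L₀ L → G
  | 0, _ => 1
  | n + 1, y => U (y, none) * timeHolonomy U n (y.shift none)

omit [TopologicalSpace G] [IsTopologicalGroup G] [CompactSpace G] [MeasurableSpace G]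
  [BorelSpace G] in
/-- The Polyakov loop: the holonomy winding once around the circle at the box site `x`, from
the circle coordinate `0` (copy of `FiniteTemperature.polyakovLine`). [cite: BorgsSeiler1983, §II.3 Lemma II.4 and Remark 1 (p. 336)] -/
def polyakovLine (U : Config d L₀ L G) (x : Fin d → ZMod L) : G :=
  timeHolonomy U L₀ ((0 : ZMod L₀), x)

omit [TopologicalSpace G] [IsTopologicalGroup G] [CompactSpace G] [MeasurableSpace G]
  [BorelSpace G] in
/-- The traced Polyakov loop `tr ρ(P_x)` (copy of `FiniteTemperature.polyakovTrace`). [cite: BorgsSeiler1983, §II.3 Lemma II.4 and Remark 1 (p. 336)] -/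
def polyakovTrace (U : Config d L₀ L G) (x : Fin d → ZMod L) : ℂ :=
  (ρ (polyakovLine U x)).trace

end SlabGauge

local notation "𝔾" => Matrix.specialUnitaryGroup (Fin 3) ℂ

/-! ### Quark variables on the circle-compactified lattice -/

/-- Gauge configurations of `ℤ_{N_t} × (ℤ/N_s)³`: an `SU(3)` matrix on every positively oriented
link (circle = direction `none`). [cite: BorgsSeiler1983, §II.3 (II.20)] -/
abbrev QCDCircleConfig (Nt Ns : ℕ) : Type := SlabGauge.Config 3 Nt Ns 𝔾

/-- Quark variable index: flavour × (site × colour × spin). [cite: MontvayMunster1994, §5.1] -/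
abbrev CircleQuarkVar (Nf Nt Ns : ℕ) : Type := Fin Nf × (SlabGauge.Site 3 Nt Ns × Fin 3 × Fin 4)

/-- A linear enumeration of the quark variables (the Berezin integral needs one). [folklore] -/
abbrev CircleFermiIdx (Nf Nt Ns : ℕ) [NeZero Nt] [NeZero Ns] : Type :=
  Fin (Fintype.card (CircleQuarkVar Nf Nt Ns))

/-- The Grassmann algebra of all `ψ̄_v, ψ_v` (`ψ̄` before `ψ`). [cite: Berezin1966, Ch. I §3] -/
abbrev CircleFermiAlg (Nf Nt Ns : ℕ) [NeZero Nt] [NeZero Ns] : Type :=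
  GrassmannAlgebra ℂ (CircleFermiIdx Nf Nt Ns ⊕ₗ CircleFermiIdx Nf Nt Ns)

variable {Nf Nt Ns : ℕ}

/-- The fixed enumeration of the quark variables (`Fintype.equivFin`). [folklore] -/
def circleQuarkEquiv [NeZero Nt] [NeZero Ns] : CircleQuarkVar Nf Nt Ns ≃ CircleFermiIdx Nf Nt Ns :=
  Fintype.equivFin _

/-! ### The flavour-twisted Wilson–Dirac matrix -/

/-- The boundary twist phase attached to the hop in direction `μ` out of the site `x`: `e^{iϑ}`
if `μ` is the circle direction and `x` lies in the last slice `t = −1 = N_t − 1` (the hop crosses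
the seam), `1` otherwise. [cite: KounoEtAl2012, §II eq. (3)] -/
def flavourTwistPhase (ϑ : ℝ) (μ : SlabGauge.Dir 3) (x : SlabGauge.Site 3 Nt Ns) : ℂ :=
  if μ = none ∧ x.1 = -1 then Complex.exp (ϑ * Complex.I) else 1

/-- At zero twist every phase is `1`. [folklore] -/
@[simp] theorem flavourTwistPhase_zero (μ : SlabGauge.Dir 3) (x : SlabGauge.Site 3 Nt Ns) :
    flavourTwistPhase 0 μ x = 1 := by
  simp [flavourTwistPhase]

/-- Hops inside the box carry no twist. [folklore] -/
@[simp] theorem flavourTwistPhase_some (ϑ : ℝ) (i : Fin 3) (x : SlabGauge.Site 3 Nt Ns) :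
    flavourTwistPhase ϑ (some i) x = 1 := by
  simp [flavourTwistPhase]

/-- The twist phases are unimodular. [folklore] -/
@[simp] theorem norm_flavourTwistPhase (ϑ : ℝ) (μ : SlabGauge.Dir 3) (x : SlabGauge.Site 3 Nt Ns) :
    ‖flavourTwistPhase ϑ μ x‖ = 1 := by
  unfold flavourTwistPhase
  split_ifs
  · exact Complex.norm_exp_ofReal_mul_I ϑ
  · exact norm_one

/-- **The `N_f`-flavour, flavour-twisted Wilson–Dirac matrix** in the `SU(3)` background `U`
(fundamental representation), bare masses `m_f`, `r = 1`, twist angles `θ_f`: flavour-diagonal,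
and on flavour `f`
`D_{(x,a,α),(y,b,β)} = (m_f + 4) δ − ½ Σ_μ [ φ_μ(x) (1 − γ_μ)_{αβ} U(x,μ)_{ab} δ_{y,x+μ̂}
 + φ_μ(y)⁻¹ (1 + γ_μ)_{αβ} (U(y,μ)⁻¹)_{ab} δ_{x,y+μ̂} ]`, `φ_μ(x) = flavourTwistPhase θ_f μ x`,
with `euclideanGamma 3` on the circle direction and `euclideanGamma i.castSucc` on the box
direction `i` (the tree's `wilsonDirac` formula, Montvay–Münster (4.85) at `a = 1` / (5.5) in
the tree's link orientation, plus the seam phases of the imaginary-chemical-potential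
prescription (5.263), (5.272) moved to the last slice). Reindexed along `circleQuarkEquiv`. [cite: MontvayMunster1994, §4.2.2 (4.85); §5.1.1 (5.5); §5.4.3 (5.263) and (5.272)] [cite: Wilson1975] -/
def qcdCircleDirac [NeZero Nt] [NeZero Ns] (U : QCDCircleConfig Nt Ns) (mq θ : Fin Nf → ℝ) :
    Matrix (CircleFermiIdx Nf Nt Ns) (CircleFermiIdx Nf Nt Ns) ℂ :=
  Matrix.reindex circleQuarkEquiv circleQuarkEquiv <| Matrix.of fun v w : CircleQuarkVar Nf Nt Ns =>
    if v.1 = w.1 then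
      (if v.2 = w.2 then ((mq v.1 + 4 : ℝ) : ℂ) else 0) -
        2⁻¹ * ∑ μ : SlabGauge.Dir 3,
          ((if w.2.1 = v.2.1.shift μ then
              flavourTwistPhase (θ v.1) μ v.2.1 *
                ((1 - euclideanGamma (μ.elim 3 Fin.castSucc)) v.2.2.2 w.2.2.2 *
                  fundamentalRep (Fin 3) (U (v.2.1, μ)) v.2.2.1 w.2.2.1)
            else 0) +
            (if v.2.1 = w.2.1.shift μ then
              (flavourTwistPhase (θ v.1) μ w.2.1)⁻¹ *
                ((1 + euclideanGamma (μ.elim 3 Fin.castSucc)) v.2.2.2 w.2.2.2 *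
                  fundamentalRep (Fin 3) ((U (w.2.1, μ))⁻¹) v.2.2.1 w.2.2.1)
            else 0))
    else 0

/-- The twisted Wilson–Dirac matrix is flavour-diagonal. [folklore] -/
theorem qcdCircleDirac_of_ne [NeZero Nt] [NeZero Ns] (U : QCDCircleConfig Nt Ns)
    (mq θ : Fin Nf → ℝ) {v w : CircleQuarkVar Nf Nt Ns} (h : v.1 ≠ w.1) :
    qcdCircleDirac U mq θ (circleQuarkEquiv v) (circleQuarkEquiv w) = 0 := by
  simp [qcdCircleDirac, h]

/-! ### The centre-stabilised Berezin–Haar functional -/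

/-- **The double-trace deformation weight** `exp(−h Σ_{x⃗} |tr P_{x⃗}|²)`, `P_{x⃗}` the Polyakov loop
around the circle at the box site `x⃗`, fundamental representation: Ünsal–Yaffe's `e^{−ΔS}`,
`ΔS = N_t^{−3} Σ_{x⃗} P[Ω(x⃗)]`, `P[Ω] = a₁|tr Ω|²` for `SU(3)` (`h = a₁/N_t³`). [cite: UnsalYaffe2008, §I (deformed action S^YM + ΔS and deformation potential P(Ω))] -/
def polyakovDeformationWeight [NeZero Nt] [NeZero Ns] (h : ℝ) (U : QCDCircleConfig Nt Ns) : ℝ :=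
  Real.exp (-(h * ∑ x : Fin 3 → ZMod Ns,
    ‖SlabGauge.polyakovTrace (fundamentalRep (Fin 3)) U x‖ ^ 2))

/-- Without deformation the weight is `1`. [folklore] -/
@[simp] theorem polyakovDeformationWeight_zero [NeZero Nt] [NeZero Ns] (U : QCDCircleConfig Nt Ns) :
    polyakovDeformationWeight 0 U = 1 := by
  simp [polyakovDeformationWeight]

/-- The deformation weight is positive. [folklore] -/
theorem polyakovDeformationWeight_pos [NeZero Nt] [NeZero Ns] (h : ℝ) (U : QCDCircleConfig Nt Ns) :
    0 < polyakovDeformationWeight h U :=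
  Real.exp_pos _

/-- **The un-normalised centre-stabilised, flavour-twisted functional**
`Z(X) = ∫∏dU ∫dψ̄dψ X(U) e^{−ψ̄ D(U;m,θ) ψ} · e^{β Σ_P Re tr U_P} · e^{−h Σ_{x⃗} |tr P_{x⃗}|²}` of a
Grassmann-valued function `X` of the gauge field: product Haar measure (`SlabGauge.haar`),
isotropic Wilson weight `SlabGauge.weight ρ β β`, double-trace deformation, signed Wilson–Dirac
Berezin factor (the orientation sign of `berezin` is common to all `X`; junk `0` if not
integrable). [cite: OsterwalderSeiler1978, §2] [cite: UnsalYaffe2008, §I] [cite: KounoEtAl2012, §II eq. (3)] -/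
def qcdCirclePartition (Nt Ns : ℕ) [NeZero Nt] [NeZero Ns] (β h : ℝ) (mq θ : Fin Nf → ℝ)
    (X : QCDCircleConfig Nt Ns → CircleFermiAlg Nf Nt Ns) : ℂ :=
  ∫ U, GrassmannAlgebra.berezin ℂ _ (X U * grassmannExp (quadratic ℂ (-qcdCircleDirac U mq θ))) *
      ((SlabGauge.weight (fundamentalRep (Fin 3)) β β U * polyakovDeformationWeight h U : ℝ) : ℂ)
    ∂(SlabGauge.haar 3 Nt Ns 𝔾)

/-- **The centre-stabilised, flavour-twisted lattice QCD expectation on `ℤ_{N_t} × (ℤ/N_s)³`**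
("QCDSlabFunctional"): `⟨X⟩ = Z(X)/Z(1)` (junk `0` if `Z(1) = 0`). [cite: OsterwalderSeiler1978, §2] [cite: UnsalYaffe2008, §I] [cite: KounoEtAl2012, §II eq. (3)] -/
def qcdCircleExpect (Nt Ns : ℕ) [NeZero Nt] [NeZero Ns] (β h : ℝ) (mq θ : Fin Nf → ℝ)
    (X : QCDCircleConfig Nt Ns → CircleFermiAlg Nf Nt Ns) : ℂ :=
  qcdCirclePartition Nt Ns β h mq θ X / qcdCirclePartition Nt Ns β h mq θ (fun _ => 1)

/-- At `h = 0` the functional is the plain Wilson × Berezin functional. [folklore] -/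
theorem qcdCirclePartition_deformation_zero (Nt Ns : ℕ) [NeZero Nt] [NeZero Ns] (β : ℝ)
    (mq θ : Fin Nf → ℝ) (X : QCDCircleConfig Nt Ns → CircleFermiAlg Nf Nt Ns) :
    qcdCirclePartition Nt Ns β 0 mq θ X =
      ∫ U, GrassmannAlgebra.berezin ℂ _ (X U * grassmannExp (quadratic ℂ (-qcdCircleDirac U mq θ))) *
        ((SlabGauge.weight (fundamentalRep (Fin 3)) β β U : ℝ) : ℂ) ∂(SlabGauge.haar 3 Nt Ns 𝔾) := by
  simp [qcdCirclePartition]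

/-- The expectation of `1` is `1` whenever the normalisation does not vanish. [folklore] -/
theorem qcdCircleExpect_one (Nt Ns : ℕ) [NeZero Nt] [NeZero Ns] (β h : ℝ) (mq θ : Fin Nf → ℝ)
    (hZ : qcdCirclePartition (Nf := Nf) Nt Ns β h mq θ (fun _ => 1) ≠ 0) :
    qcdCircleExpect (Nf := Nf) Nt Ns β h mq θ (fun _ => 1) = 1 :=
  div_self hZ

/-! ### Local observables of `ℤ⁴` placed on `ℤ_{N_t} × (ℤ/N_s)³` (circle = coordinate `3`) -/

/-- The lattice site below the point `y ∈ ℤ⁴`: circle coordinate `y 3 mod N_t`, box coordinates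
`(y 0, y 1, y 2) mod N_s`. [folklore] -/
def circleSite (Nt Ns : ℕ) (y : Fin 4 → ℤ) : SlabGauge.Site 3 Nt Ns :=
  (((y 3 : ℤ) : ZMod Nt), fun j : Fin 3 => ((y j.castSucc : ℤ) : ZMod Ns))

/-- The `(N_s, N_s, N_s, N_t)`-periodic lift of a gauge field to `ℤ⁴`: the link `(y, i)` of `ℤ⁴`
reads the link at `circleSite y` in direction `finSuccEquiv' 3 i` (`3 ↦ none` = the circle,
`j.castSucc ↦ some j`). [folklore] -/
def circleGaugeLift (Nt Ns : ℕ) (U : QCDCircleConfig Nt Ns) : LGConfig 4 𝔾 :=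
  fun e => U (circleSite Nt Ns e.1, finSuccEquiv' 3 e.2)

/-- `circleGaugeLift` unfolded. [folklore] -/
@[simp] theorem circleGaugeLift_apply (Nt Ns : ℕ) (U : QCDCircleConfig Nt Ns) (e : ZdEdge 4) :
    circleGaugeLift Nt Ns U e = U (circleSite Nt Ns e.1, finSuccEquiv' 3 e.2) := rfl

/-- The axis of `ℤ⁴` of a lattice direction, as the route's items write it (`μ.elim 3
Fin.castSucc`: the circle is coordinate `3`, the box direction `j` is `j.castSucc`), is the
inverse of `finSuccEquiv' 3` used by `circleGaugeLift`. [folklore] -/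
theorem finSuccEquiv'_symm_three (μ : SlabGauge.Dir 3) :
    (finSuccEquiv' (3 : Fin 4)).symm μ = μ.elim 3 Fin.castSucc := by
  cases μ with
  | none => rfl
  | some j => exact (finSuccEquiv'_symm_some (3 : Fin 4) j).trans (Fin.succAbove_last_apply j)

/-- `finSuccEquiv' 3` of the axis of `μ` is `μ`. [folklore] -/
@[simp] theorem finSuccEquiv'_three_elim (μ : SlabGauge.Dir 3) :
    finSuccEquiv' (3 : Fin 4) (μ.elim 3 Fin.castSucc) = μ := by
  rw [← finSuccEquiv'_symm_three, Equiv.apply_symm_apply]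

/-- The projection `ℤ⁴ → ℤ_{N_t} × (ℤ/N_s)³` intertwines the unit shift of `ℤ⁴` along the axis of
`μ` with the lattice shift `SlabGauge.Site.shift · μ`. [folklore] -/
@[simp] theorem circleSite_add_single (Nt Ns : ℕ) (x : Fin 4 → ℤ) (μ : SlabGauge.Dir 3) :
    circleSite Nt Ns (x + Pi.single (μ.elim 3 Fin.castSucc) 1) = (circleSite Nt Ns x).shift μ := by
  have h3 : ∀ j : Fin 3, (Fin.castSucc j : Fin 4) ≠ 3 := by decide
  cases μ with
  | none =>
      simp only [circleSite, Option.elim, SlabGauge.Site.shift, Pi.add_apply, Pi.single_eq_same,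
        Int.cast_add, Int.cast_one, Prod.mk.injEq, true_and]
      funext j
      simp [Pi.single_eq_of_ne (h3 j)]
  | some i =>
      simp only [circleSite, Option.elim, SlabGauge.Site.shift, Pi.add_apply, Prod.mk.injEq]
      refine ⟨by simp [Pi.single_eq_of_ne (h3 i).symm], ?_⟩
      funext j
      by_cases h : j = i
      · subst h; simp
      · simp [h, (Fin.castSucc_injective 3).ne h]

/-- **Plaquettes of the lift are the plaquettes of `ℤ_{N_t} × (ℤ/N_s)³`**: the `ℤ⁴`-plaquette
holonomy of `circleGaugeLift Nt Ns U` at `x` in the plane of the axes of `μ, ν` is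
`SlabGauge.plaquette U (circleSite Nt Ns x) μ ν`, so the tree's gluonic cylinder observables read
through the lift are the lattice ones. [folklore] -/
theorem plaquetteHolonomyZd_circleGaugeLift (Nt Ns : ℕ) (U : QCDCircleConfig Nt Ns) (x : Fin 4 → ℤ)
    (μ ν : SlabGauge.Dir 3) :
    plaquetteHolonomyZd (circleGaugeLift Nt Ns U) x (μ.elim 3 Fin.castSucc) (ν.elim 3 Fin.castSucc) =
      SlabGauge.plaquette U (circleSite Nt Ns x) μ ν := by
  simp [plaquetteHolonomyZd, SlabGauge.plaquette]

/-- The quark variable of the boxed quark variable `i` translated by `v ∈ ℤ⁴` (flavour, colour,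
spin unchanged; site `x + v` read through `circleSite`). [folklore] -/
def circleQuarkVarOfBox {R : ℕ} (Nt Ns : ℕ) (v : Fin 4 → ℤ) (i : BoxFermiIdx Nf R) :
    CircleQuarkVar Nf Nt Ns :=
  let q := boxQuarkEquiv.symm i
  let y : Fin 4 → ℤ := (q.2.1 : Fin 4 → ℤ) + v
  (q.1, (circleSite Nt Ns y, q.2.2))

/-- **The observable `A` placed at `v`**: links read through the periodic lift translated by `v`
(`U ↦ A.F (τ_v Ũ)`, `τ_v Ũ (x, i) = Ũ (x + v, i)`), quark generators `ψ̄_w, ψ_w` sent to the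
generators at `circleQuarkVarOfBox v w` (the algebra map induced on generators; the analogue of
`onTorus`). [cite: OsterwalderSeiler1978, §2] -/
def QCDLatticeObservable.onCircle {R : ℕ} (A : QCDLatticeObservable Nf R) (Nt Ns : ℕ) [NeZero Nt]
    [NeZero Ns] (v : Fin 4 → ℤ) (U : QCDCircleConfig Nt Ns) : CircleFermiAlg Nf Nt Ns :=
  ExteriorAlgebra.map
      (Fintype.linearCombination ℂ fun w : BoxFermiIdx Nf R ⊕ₗ BoxFermiIdx Nf R =>
        let f := fun i : BoxFermiIdx Nf R => circleQuarkEquiv (circleQuarkVarOfBox Nt Ns v i)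
        Pi.single (toLex (Sum.map f f (ofLex w)) : CircleFermiIdx Nf Nt Ns ⊕ₗ CircleFermiIdx Nf Nt Ns)
          (1 : ℂ))
    (A.F (configShift (-v) (circleGaugeLift Nt Ns U)))

/-- The unit observable stays the unit. [folklore] -/
@[simp] theorem QCDLatticeObservable.onCircle_one {R : ℕ} (Nt Ns : ℕ) [NeZero Nt] [NeZero Ns]
    (v : Fin 4 → ℤ) (U : QCDCircleConfig Nt Ns) :
    (QCDLatticeObservable.one Nf R).onCircle Nt Ns v U = 1 :=
  map_one _

/-- **Connected correlation along the non-compact direction `0`**: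
`⟨A(0) · B(n e₀)⟩ − ⟨A(0)⟩⟨B(n e₀)⟩` in the centre-stabilised, flavour-twisted theory, `B`
translated by `n` lattice units in the direction `0` of `ℤ⁴` (a box direction; the circle is
coordinate `3`). [cite: OsterwalderSeiler1978, §§2–4] -/
def qcdCircleConnectedCorr {R R' : ℕ} (Nt Ns : ℕ) [NeZero Nt] [NeZero Ns] (β h : ℝ)
    (mq θ : Fin Nf → ℝ) (A : QCDLatticeObservable Nf R) (B : QCDLatticeObservable Nf R')
    (n : ℕ) : ℂ :=
  qcdCircleExpect Nt Ns β h mq θ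
      (fun U => A.onCircle Nt Ns 0 U * B.onCircle Nt Ns (Pi.single 0 (n : ℤ)) U) -
    qcdCircleExpect Nt Ns β h mq θ (A.onCircle Nt Ns 0) *
      qcdCircleExpect Nt Ns β h mq θ (B.onCircle Nt Ns (Pi.single 0 (n : ℤ)))

/-- Sanity check: the connected correlation with the unit observable vanishes (when the
normalisation does not). [folklore] -/
theorem qcdCircleConnectedCorr_one_right {R R' : ℕ} (Nt Ns : ℕ) [NeZero Nt] [NeZero Ns]
    (β h : ℝ) (mq θ : Fin Nf → ℝ) (A : QCDLatticeObservable Nf R) (n : ℕ)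
    (hZ : qcdCirclePartition (Nf := Nf) Nt Ns β h mq θ (fun _ => 1) ≠ 0) :
    qcdCircleConnectedCorr Nt Ns β h mq θ A (QCDLatticeObservable.one Nf R') n = 0 := by
  have h1 : (QCDLatticeObservable.one Nf R').onCircle Nt Ns (Pi.single 0 (n : ℤ)) =
      fun _ : QCDCircleConfig Nt Ns => (1 : CircleFermiAlg Nf Nt Ns) :=
    funext fun U => QCDLatticeObservable.onCircle_one Nt Ns _ U
  have h2 : (fun U => A.onCircle Nt Ns 0 U *
      (QCDLatticeObservable.one Nf R').onCircle Nt Ns (Pi.single 0 (n : ℤ)) U) = A.onCircle Nt Ns 0 := by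
    funext U; rw [QCDLatticeObservable.onCircle_one, mul_one]
  unfold qcdCircleConnectedCorr
  rw [h2, h1, qcdCircleExpect_one Nt Ns β h mq θ hZ, mul_one, sub_self]

/-! ### Volume-uniform clustering along a regularisation -/

/-- **Clustering of the centre-stabilised theory at rate `Δ` (physical units) along the
regularisation `reg` at renormalised masses `m`**, under the deformation profile `hP` and the
twist profile `θP`, in the window `P`: for every pair `A, B` of gauge-invariant local lattice QCD
observables there is `C` such that for all large `k`, every circle length `N_t ≥ 1` with
`P k N_t`, every box `2S+1 ≥ N_t` and every separation `n ≤ S`, at the bare point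
`(β_k, m_f(k) = (reg.scheme m 0 0).mq f k, hP k N_t, θP k N_t)`,
`‖⟨A · τ_{n e₀} B⟩ − ⟨A⟩⟨B⟩‖ ≤ C e^{−Δ a_k n}`. The common tail of the route's items (window
`a_k N_t ∈ [ℓ₀, 2ℓ₀]` for the small circle, `a_k N_t ≥ ℓ₀` for continuity). [cite: OsterwalderSeiler1978, §§2–4] [cite: UnsalYaffe2008, §I] -/
def QCDRegularisation.HasCircleClusteringAt (reg : QCDRegularisation Nf) (m : Fin Nf → ℝ)
    (P : ℕ → ℕ → Prop) (hP : ℕ → ℕ → ℝ) (θP : ℕ → ℕ → Fin Nf → ℝ) (Δ : ℝ) : Prop :=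
  ∀ (R R' : ℕ) (A : QCDLatticeObservable Nf R) (B : QCDLatticeObservable Nf R'), ∃ C : ℝ,
    ∀ᶠ k in atTop, ∀ (Nt : ℕ) [NeZero Nt], P k Nt → ∀ S : ℕ, Nt ≤ 2 * S + 1 → ∀ n : ℕ, n ≤ S →
      ‖qcdCircleConnectedCorr Nt (2 * S + 1) (reg.β k) (hP k Nt)
          (fun f => (reg.scheme m 0 0).mq f k) (θP k Nt) A B n‖ ≤
        C * Real.exp (-(Δ * (reg.a k * n)))

/-- **Clustering at some positive rate** (`∃ Δ > 0`, `HasCircleClusteringAt`): definitionally the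
`Gap reg m P hP θP` of the route's items. [cite: OsterwalderSeiler1978, §§2–4] [cite: UnsalYaffe2008, §I] -/
def QCDRegularisation.HasCircleClustering (reg : QCDRegularisation Nf) (m : Fin Nf → ℝ)
    (P : ℕ → ℕ → Prop) (hP : ℕ → ℕ → ℝ) (θP : ℕ → ℕ → Fin Nf → ℝ) : Prop :=
  ∃ Δ : ℝ, 0 < Δ ∧ reg.HasCircleClusteringAt m P hP θP Δ

/-- Shrinking the window preserves clustering. [folklore] -/
theorem QCDRegularisation.HasCircleClusteringAt.mono {reg : QCDRegularisation Nf}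
    {m : Fin Nf → ℝ} {P P' : ℕ → ℕ → Prop} {hP : ℕ → ℕ → ℝ} {θP : ℕ → ℕ → Fin Nf → ℝ} {Δ : ℝ}
    (h : reg.HasCircleClusteringAt m P hP θP Δ) (hPP' : ∀ k Nt, P' k Nt → P k Nt) :
    reg.HasCircleClusteringAt m P' hP θP Δ := by
  intro R R' A B
  obtain ⟨C, hC⟩ := h R R' A B
  exact ⟨C, hC.mono fun k hk Nt _ hPk => hk Nt (hPP' k Nt hPk)⟩

/-- Lowering the rate preserves clustering (`a_k > 0`, and a bound `‖·‖ ≤ C e^{−t}` forces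
`C ≥ 0`). [folklore] -/
theorem QCDRegularisation.HasCircleClusteringAt.of_le {reg : QCDRegularisation Nf}
    {m : Fin Nf → ℝ} {P : ℕ → ℕ → Prop} {hP : ℕ → ℕ → ℝ} {θP : ℕ → ℕ → Fin Nf → ℝ} {Δ Δ' : ℝ}
    (h : reg.HasCircleClusteringAt m P hP θP Δ) (hΔ : Δ' ≤ Δ) :
    reg.HasCircleClusteringAt m P hP θP Δ' := by
  intro R R' A B
  obtain ⟨C, hC⟩ := h R R' A B
  refine ⟨C, hC.mono fun k hk Nt _ hPk S hS n hn => ?_⟩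
  have hkn := hk Nt hPk S hS n hn
  have ht : 0 ≤ reg.a k * n := mul_nonneg (reg.a_pos k).le n.cast_nonneg
  have hC0 : 0 ≤ C :=
    nonneg_of_mul_nonneg_left ((norm_nonneg _).trans hkn) (Real.exp_pos _)
  refine hkn.trans (mul_le_mul_of_nonneg_left (Real.exp_le_exp.mpr ?_) hC0)
  exact neg_le_neg (mul_le_mul_of_nonneg_right hΔ ht)

/-- Shrinking the window preserves clustering at a positive rate. [folklore] -/
theorem QCDRegularisation.HasCircleClustering.mono {reg : QCDRegularisation Nf} {m : Fin Nf → ℝ}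
    {P P' : ℕ → ℕ → Prop} {hP : ℕ → ℕ → ℝ} {θP : ℕ → ℕ → Fin Nf → ℝ}
    (h : reg.HasCircleClustering m P hP θP) (hPP' : ∀ k Nt, P' k Nt → P k Nt) :
    reg.HasCircleClustering m P' hP θP := by
  obtain ⟨Δ, hΔ, hc⟩ := h
  exact ⟨Δ, hΔ, hc.mono hPP'⟩

end Literature.MathematicalPhysics.QuantumFieldTheory

end
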